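import Literature.MathematicalPhysics.QuantumFieldTheory.Balaban1983to89.B9Eq310HessianOperator
import Literature.MathematicalPhysics.QuantumFieldTheory.Balaban1983to89.B9Eq319QprimeTorus

/-!
# `Balaban1983to89.B9Eq326OperatorAssembly` — T. Bałaban, *Propagators for lattice gauge theories in a background field*, Commun. Math. Phys.
# **99** (1985) 389–434 [Balaban1985BackgroundPropagators] (3.26) p. 395 (with (3.10) p. 392, (3.19)–(3.23) pp. 393–394) and
# [Balaban1985Variational] (110) p. 294: THE OPERATOR `Δ_a(U) = Δ(U) + D R(U) D* + Q*(U) a Q(U)` ASSEMBLED FROM THE BACKGROUND on the `L²`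
# space of `𝔤ᶜ`-valued bond functions of the periodic lattice — the Hessian `Δ(U)` (`B9Eq310HessianOperator.hessOp`), the projection
# `R(U)` onto `Δ_U N(Q′(U))` (`B11Eq103H1Complex.RLatticeK` at the CONCRETE `Q′(U)` of `B9Eq319QprimeTorus.QprimeLin`), `D`, `D*`; only the
# vector-field averaging `Q(U)` and the number `a` remain data; hence `G₁`, `H₁`, `𝔊` of the pub-balaban NE9 letter chain at these letters

statement-level skeleton of published theorems with citation tags; proofs where landed; nothing here is a claim
about the Yang–Mills mass gap

PDF held: `paper:balaban1985-cmp99-background-propagators` (journal page = PDF page + 388), p. 395 read by this seat (2026-08-21) in the held text.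

THE PRINT (verbatim, p. 395).  *«Now we are ready to define one of the basic operators of this paper. It is an immediate generalization of the
operator Δ_a given by (2.19) in [4]. We define Δ_a(U) = Δ(U) + D_U R(U) D*_U + Q*(U)aQ(U), (3.26) or simply Δ_a = Δ + DRD* + Q*aQ. It coincides with
Δ_a in (2.19) if U = 1.»*  [B11] p. 294: *«We denote by G₁ an inverse operator to the operator Δ₁ + DRD* + aQ*Q.»*

WHY THIS FILE (cell context).  The capstone of the pub-balaban NE9 owner's gen-77 bricks: `B11Eq103H1Complex.laplaceALatticeK c R S Δ₁ Rr Q a` took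
`Δ₁`, `Rr`, `Q`, `a` as DATA; `B9Eq310HessianOperator.hessOp` constructs `Δ(U)`, `B11Eq103H1Complex.RLatticeK` constructs `R` from `Q′`, and
`B9Eq319QprimeTorus.QprimeLin` constructs `Q′(U)` on the torus `TSite d (L·m)`.  This file plugs them together: `Δ_a(U)` of (3.26) with ONLY the
vector averaging `Q(U)` ([B7] (124) / [B9] (3.15); ℤ^d version `B7Eq122LinearPartIsLinear.linQOp`) and `a` left as data, and the letters `G₁`, `H₁`
(with (45)₁), `𝔊` of the chain AT these assembled letters.

WHAT IS DEFINED AND PROVED (sorry-free; no `Prop` placeholder; no inequality of the paper).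
* `QprimeW φ U` — the concrete `Q′(U)` of (3.19) read on the `L²` space of `W`-valued site functions (`QprimeLin` at the transporters `R(U(b))` on the
  Hilbert fibre, `B9Eq310HessianOperator.adTransportW`); `QprimeW_surjective` (ONTO, by `QprimeLin_surjective`).
* `RofU φ η U` — `R(U)` of (3.21) := `RLatticeK ((η : ℂ)⁻¹) (R(U)) (R(U⁻¹)) (QprimeW φ U)`; `RofU_isSymmetric`.
* **`laplaceAofU φ η U τ Q a`** — (3.26) `Δ_a(U) = Δ(U) + D R(U) D* + Q* a Q` := `laplaceALatticeK` at `Δ₁ := hessOp φ η U τ`, `Rr := RofU φ η U`;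
  `laplaceAofU_eq` (unfolding).
* `G1ofU`, `H1ofU` (+ **`Q_H1ofU`** = (45)₁), `frakGofU` — the chain's letters at the assembled operator (positivity [B9] Thm 3.11 and `Q` onto displayed).
MODEL / DECLARED READINGS.  (M1) as the three imported files: torus `TSite d (L·m)` (one averaging step), Hilbert fibre `W` and algebra `𝔸 ⊇ 𝔤ᶜ`
identified by `φ`, trace datum `τ`, uniform weight `c₀ = η^d`, scalar `η⁻¹`, transporters `R(U(b))` / `R(U(b)⁻¹)` read on `W`.  (M2) DATA: `Q`
(vector averaging; the torus version of `linQOp` is not in the tree), `a`; DISPLAYED: positivity of `Δ_a(U)` ([B9] Thm 3.11 — NOT proved), `Q`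
onto ([B9]/[B7]), everything (3.124)-related.  (M3) one averaging level only (the multi-level `Q′_j`, `Q_j`, `a_j` of (3.16)/(3.24) are not assembled).
HONEST SCOPE.  Assembly of the cell's own objects at printed formulas; no estimate; NOT summit progress (cell pub-balaban: NE9 NOT PRINTED / NOT
PROVED; spine PROVED 0/9).  Filed by the pub-balaban NE9 BINDER-row owner lineage `b2b-balaban-t4-ne9-p1` (gen 77); NEW file importing
`B9Eq310HessianOperator` and `B9Eq319QprimeTorus`; nothing modified.  Net new unproved facts: 0.
-/

noncomputable section

open scoped InnerProductSpace ComplexConjugate BigOperators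

namespace Literature.MathematicalPhysics.QuantumFieldTheory.Balaban1983to89.B9Eq326OperatorAssembly

open B4Sect5Torus (TSite)
open B9SectCLatticeCarrier (Bond)
open B9Eq311L2Pairing (WL2)
open B11Eq103H1Complex (SiteL2K BondL2K laplaceALatticeK RLatticeK RLatticeK_isSymmetric G1LatticeK H1LatticeK Q_H1LatticeK frakGLatticeK)
open B9Eq310HessianOperator (adTransportW hessOp)
open B9Eq319QprimeTorus (fineP QprimeLin QprimeLin_surjective)

variable {d : ℕ} (L : ℕ) [NeZero L] (m : Fin d → ℕ) {𝔸 : Type*} [Ring 𝔸] [Algebra ℂ 𝔸]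
  {W : Type*} [NormedAddCommGroup W] [InnerProductSpace ℂ W] (φ : W ≃ₗ[ℂ] 𝔸) {c₀ : ℝ} (η : ℝ) (U : Bond d (fineP L m) → 𝔸ˣ)

/-- **`Q′(U)` of (3.19) on the `L²` space of the `W`-valued gauge parameters of the torus `TSite d (L·m)`** — `B9Eq319QprimeTorus.QprimeLin` at the
transporters `R(U(b))` read on the Hilbert fibre, composed with the identification of the weighted `L²` space with the functions.
[cite: Balaban1985BackgroundPropagators, (3.19) p.393] -/
def QprimeW : SiteL2K ℂ d (fineP L m) c₀ W →ₗ[ℂ] (TSite d m → W) :=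
  QprimeLin L m (adTransportW φ U) ∘ₗ (WL2.linearEquiv ℂ ℂ (fun _ : TSite d (fineP L m) => c₀)).toLinearMap

/-- `Q′(U)` on the `L²` space is onto. [cite: Balaban1985BackgroundPropagators, (3.19) p.393] -/
theorem QprimeW_surjective : Function.Surjective (QprimeW L m φ U (c₀ := c₀)) :=
  (QprimeLin_surjective L m (adTransportW φ U)).comp (WL2.linearEquiv ℂ ℂ (fun _ : TSite d (fineP L m) => c₀)).surjective

variable [FiniteDimensional ℂ W] [Fact (0 < c₀)]

/-- **`R(U)` of (3.21) AT THE CONCRETE `Q′(U)`**: the orthogonal projection onto `Δ_U N(Q′(U))` in the `L²` space of the gauge parameters, with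
`Δ_U = D*_U D_U` at the transporters `R(U(b))`, `R(U(b)⁻¹)` and the scalar `η⁻¹`. [cite: Balaban1985BackgroundPropagators, (3.21)–(3.23) p.394] -/
def RofU : SiteL2K ℂ d (fineP L m) c₀ W →ₗ[ℂ] SiteL2K ℂ d (fineP L m) c₀ W :=
  RLatticeK ((η : ℂ))⁻¹ (adTransportW φ U) (adTransportW φ fun b => (U b)⁻¹) (QprimeW L m φ U)

/-- `R(U)` is symmetric. [cite: Balaban1985BackgroundPropagators, (3.21) p.394] -/
theorem RofU_isSymmetric : (RofU L m φ η U (c₀ := c₀)).IsSymmetric := RLatticeK_isSymmetric _ _ _ _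

variable [StarRing 𝔸] [StarModule ℂ 𝔸] (τ : 𝔸 →ₗ[ℂ] ℂ) {F : Type*} [NormedAddCommGroup F] [InnerProductSpace ℂ F] [FiniteDimensional ℂ F]

/-- **(3.26) `Δ_a(U) = Δ(U) + D_U R(U) D*_U + Q*(U) a Q(U)` ASSEMBLED**: `laplaceALatticeK` at `Δ₁ := hessOp φ η U τ` ((3.10), `B9Eq310HessianOperator`),
`Rr := RofU φ η U` ((3.21) at the concrete (3.19)), `D`/`D*` = (3.3)/(3.8) at `R(U(b))`/`R(U(b)⁻¹)`, `Q* := Q†`; DATA: the vector averaging `Q = Q(U)`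
and `a`. [cite: Balaban1985BackgroundPropagators, (3.26) p.395; Balaban1985Variational, (110) p.294] -/
def laplaceAofU (Q : BondL2K ℂ d (fineP L m) c₀ W →ₗ[ℂ] F) (a : ℝ) : BondL2K ℂ d (fineP L m) c₀ W →ₗ[ℂ] BondL2K ℂ d (fineP L m) c₀ W :=
  laplaceALatticeK ((η : ℂ))⁻¹ (adTransportW φ U) (adTransportW φ fun b => (U b)⁻¹) (hessOp φ η U τ) (RofU L m φ η U) Q a

/-- Unfolding (3.26) at the assembled letters. [cite: Balaban1985BackgroundPropagators, (3.26) p.395] -/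
theorem laplaceAofU_eq (Q : BondL2K ℂ d (fineP L m) c₀ W →ₗ[ℂ] F) (a : ℝ) :
    laplaceAofU L m φ η U τ Q a =
      laplaceALatticeK ((η : ℂ))⁻¹ (adTransportW φ U) (adTransportW φ fun b => (U b)⁻¹) (hessOp φ η U τ) (RofU L m φ η U) Q a := rfl

variable {Q : BondL2K ℂ d (fineP L m) c₀ W →ₗ[ℂ] F} {a : ℝ}
  (hpos : ∀ x : BondL2K ℂ d (fineP L m) c₀ W, x ≠ 0 → 0 < RCLike.re ⟪x, laplaceAofU L m φ η U τ Q a x⟫_ℂ) (hQ : Function.Surjective Q)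

/-- **`G₁(U) = Δ_a(U)⁻¹`** at the assembled operator (positivity = [B9] Thm 3.11, displayed). [cite: Balaban1985Variational, (110) p.294; Balaban1985BackgroundPropagators, Thm 3.11 p.416] -/
def G1ofU : BondL2K ℂ d (fineP L m) c₀ W →ₗ[ℂ] BondL2K ℂ d (fineP L m) c₀ W := G1LatticeK hpos

/-- **`H₁(U) = G₁Q*(QG₁Q*)⁻¹`** at the assembled operator. [cite: Balaban1985Variational, (45) p.285, (103) p.293] -/
def H1ofU : F →ₗ[ℂ] BondL2K ℂ d (fineP L m) c₀ W := H1LatticeK hpos hQ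

/-- **(45)₁ `Q(H₁b) = b`** at the assembled operator — hypothesis-free given `Q`, `a`, the displayed positivity and `Q` onto.
[cite: Balaban1985Variational, (45) p.285] -/
theorem Q_H1ofU (b : F) : Q (H1ofU L m φ η U τ hpos hQ b) = b := Q_H1LatticeK hpos hQ b

/-- **`𝔊(U)`** of [B11] (110)–(111) / [B9] (3.153) at the assembled operator. [cite: Balaban1985Variational, (110)–(111) p.294] -/
def frakGofU : BondL2K ℂ d (fineP L m) c₀ W →ₗ[ℂ] BondL2K ℂ d (fineP L m) c₀ W := frakGLatticeK hpos hQ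

end Literature.MathematicalPhysics.QuantumFieldTheory.Balaban1983to89.B9Eq326OperatorAssembly

end
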